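import Literature.AlgebraicTopology.FundamentalGroup.CircleValuedCollapse
import Literature.AlgebraicTopology.FundamentalGroup.CircleValuedWindingCrossing
import HarnessLib

/-!
# Winding homomorphisms are unchanged by a real perturbation; comparison of two collapses

Topic `Literature/AlgebraicTopology/FundamentalGroup`; a proved complement to
`CircleValuedWinding.lean` (the winding homomorphism `π₁(X, x) → π₁(ℝ/ℤ, θ x) ≅ ℤ` of a
continuous `θ : X → ℝ/ℤ`, evaluated by real lifts: `wind_fromPath_eq_of_lift`) and
`CircleValuedCollapse.lean` (the Pontryagin–Thom collapse `circleCollapse K ρ` of a normal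
coordinate `K` with cut-off `ρ`).  **Everything here is proved; no definitions, no named facts.**

The point of this file is an elementary substitute for the homotopy invariance of induced maps
on `π₁` (Hatcher, *Algebraic Topology* (2002), Prop. 1.18 / Lemma 1.19), in the one case needed
for comparing collapse maps: if two circle-valued maps differ by (the projection of) a
continuous **real** function, `θ = θ′ + [D]`, then their winding homomorphisms agree on every
loop — a lift of `θ′ ∘ γ` plus `D ∘ γ` is a lift of `θ ∘ γ` with the same increment
(`wind_eq_of_eq_add_coe`); if `θ = -θ′ + [D]` the winding numbers are opposite
(`wind_eq_inv_of_eq_neg_add_coe`).  In both cases the two winding homomorphisms have the same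
kernel (`ker_windingHom_eq_of_eq_add_coe`, `ker_windingHom_eq_of_eq_neg_add_coe`).

Application (`circleCollapse_eq_circleCollapse_add_coe`, `continuous_collapseDiff`): two
collapses `circleCollapse K ρ`, `circleCollapse K′ ρ` with the SAME cut-off `ρ` and normal
coordinates `K`, `K′` of the same strict sign off the hypersurface `P` (on the neighbourhood `N`
carrying them) differ by `[D]` with
`D = clampHalf (K/ρ) - clampHalf (K′/ρ)` (`= 0` where `ρ = 0`, by the convention `s / 0 = 0`), which is a CONTINUOUS real
function: near `P` both coordinates are continuous, and where the cut-off dies both clamps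
saturate at the same `±1/2`.  Hence the two collapses have the same winding homomorphism up to
sign (`ker_windingHom_circleCollapse_eq`, `ker_windingHom_circleCollapse_eq_of_neg`) — the form
in which "the intersection number with a two-sided hypersurface does not depend on the choice of
the normal coordinate" is used by the `π₁`-obstruction to non-separating reducing curves of
trisections (`Literature/Topology/FourManifolds/TrisectionFunctorGKPi1Obstruction.lean`: three
compressing discs of one curve `δ` in three handlebodies give three collapses on the central
surface with the common zero set `δ`, to be compared).

## References

* A. Hatcher, *Algebraic Topology*, CUP (2002), Thm. 1.7 (p. 29) and its proof, Prop. 1.30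
  (uniqueness of lifts), Prop. 1.18. [HatcherAT2002]
* J. Milnor, *Topology from the differentiable viewpoint*, Univ. Press of Virginia (1965), §5
  (the degree does not depend on auxiliary choices).
-/

noncomputable section

open scoped unitInterval Topology
open Set Function Filter

namespace Literature.AlgebraicTopology.FundamentalGroup

/-! ### Real perturbations of circle-valued maps -/

section Perturbation

variable {X : Type*} [TopologicalSpace X]

/-- **A global real lift of `θ ∘ γ`** (path lifting for the covering `ℝ → ℝ/ℤ`,
Hatcher Prop. 1.30). [cite: HatcherAT2002, Prop. 1.30] -/
theorem exists_lift (θ : C(X, AddCircle (1 : ℝ))) {x : X} (γ : Path x x) :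
    ∃ Λ : I → ℝ, Continuous Λ ∧ ∀ t, ((Λ t : ℝ) : AddCircle (1 : ℝ)) = θ (γ t) := by
  set cov := AddCircle.isCoveringMap_coe (1 : ℝ)
  obtain ⟨e, he⟩ := QuotientAddGroup.mk_surjective (θ x)
  set δ : C(I, AddCircle (1 : ℝ)) := (γ.map θ.continuous).toContinuousMap with hδ
  have hδ0 : δ 0 = ((e : ℝ) : AddCircle (1 : ℝ)) := by
    change θ (γ 0) = _
    rw [γ.source]
    exact he.symm
  obtain ⟨Γ, hΓ, -⟩ := cov.exists_path_lifts δ e hδ0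
  exact ⟨Γ, Γ.continuous, fun t => congrFun hΓ t⟩

/-- The two ends of a real lift of `θ ∘ γ` (`γ` a loop) differ by an integer. [folklore] -/
theorem exists_int_lift_one_eq (θ : C(X, AddCircle (1 : ℝ))) {x : X} (γ : Path x x)
    {Λ : I → ℝ} (hlift : ∀ t, ((Λ t : ℝ) : AddCircle (1 : ℝ)) = θ (γ t)) :
    ∃ n : ℤ, Λ 1 = Λ 0 + n := by
  have h : (((Λ 1 - Λ 0 : ℝ)) : AddCircle (1 : ℝ)) = 0 := by
    rw [AddCircle.coe_sub, hlift, hlift, γ.source, γ.target, sub_self]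
  rw [AddCircle.coe_eq_zero_iff (1 : ℝ)] at h
  obtain ⟨n, hn⟩ := h
  exact ⟨n, by rw [zsmul_eq_mul, mul_one] at hn; linarith⟩

/-- **The winding number is unchanged by a real perturbation.**  If `θ = θ′ + [D]` pointwise for
a continuous real function `D`, then for every loop `γ` at `x` the winding homomorphisms of `θ`
and `θ′` take the same value on `[γ]`: a lift `Λ′` of `θ′ ∘ γ` gives the lift `Λ′ + D ∘ γ` of
`θ ∘ γ`, with the same increment since `D (γ 1) = D (γ 0)`.
[cite: HatcherAT2002, Thm. 1.7 (p. 29) and its proof] -/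
theorem wind_eq_of_eq_add_coe (θ θ' : C(X, AddCircle (1 : ℝ))) {D : X → ℝ} (hD : Continuous D)
    (h : ∀ y, θ y = θ' y + ((D y : ℝ) : AddCircle (1 : ℝ))) {x : X} (γ : Path x x) :
    fundamentalGroupAddCircleEquiv one_ne_zero (θ x)
        (_root_.FundamentalGroup.map θ x
          (_root_.FundamentalGroup.fromPath (Path.Homotopic.Quotient.mk γ))) =
      fundamentalGroupAddCircleEquiv one_ne_zero (θ' x)
        (_root_.FundamentalGroup.map θ' x
          (_root_.FundamentalGroup.fromPath (Path.Homotopic.Quotient.mk γ))) := by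
  obtain ⟨Λ', hΛ', hlift'⟩ := exists_lift θ' γ
  obtain ⟨n, hn⟩ := exists_int_lift_one_eq θ' γ hlift'
  set Λ : I → ℝ := fun t => Λ' t + D (γ t) with hΛ
  have hΛc : Continuous Λ := hΛ'.add (hD.comp γ.continuous)
  have hlift : ∀ t, ((Λ t : ℝ) : AddCircle (1 : ℝ)) = θ (γ t) := fun t => by
    rw [hΛ, AddCircle.coe_add, hlift' t, h (γ t)]
  have hends : Λ 1 = Λ 0 + n := by
    simp only [hΛ, γ.source, γ.target]
    rw [hn]; ring
  rw [wind_fromPath_eq_of_lift θ γ Λ hΛc hlift n hends,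
    wind_fromPath_eq_of_lift θ' γ Λ' hΛ' hlift' n hn]

/-- **A sign change inverts the winding number**: if `θ = -θ′ + [D]` pointwise for a continuous
real `D`, the winding homomorphisms of `θ` and `θ′` take inverse values on every loop (the lift
`-Λ′ + D ∘ γ`). [cite: HatcherAT2002, Thm. 1.7 (p. 29) and its proof] -/
theorem wind_eq_inv_of_eq_neg_add_coe (θ θ' : C(X, AddCircle (1 : ℝ))) {D : X → ℝ}
    (hD : Continuous D) (h : ∀ y, θ y = -θ' y + ((D y : ℝ) : AddCircle (1 : ℝ))) {x : X}
    (γ : Path x x) :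
    fundamentalGroupAddCircleEquiv one_ne_zero (θ x)
        (_root_.FundamentalGroup.map θ x
          (_root_.FundamentalGroup.fromPath (Path.Homotopic.Quotient.mk γ))) =
      (fundamentalGroupAddCircleEquiv one_ne_zero (θ' x)
        (_root_.FundamentalGroup.map θ' x
          (_root_.FundamentalGroup.fromPath (Path.Homotopic.Quotient.mk γ))))⁻¹ := by
  obtain ⟨Λ', hΛ', hlift'⟩ := exists_lift θ' γ
  obtain ⟨n, hn⟩ := exists_int_lift_one_eq θ' γ hlift'
  set Λ : I → ℝ := fun t => -Λ' t + D (γ t) with hΛ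
  have hΛc : Continuous Λ := hΛ'.neg.add (hD.comp γ.continuous)
  have hlift : ∀ t, ((Λ t : ℝ) : AddCircle (1 : ℝ)) = θ (γ t) := fun t => by
    rw [hΛ, AddCircle.coe_add, AddCircle.coe_neg, hlift' t, h (γ t)]
  have hends : Λ 1 = Λ 0 + ((-n : ℤ) : ℝ) := by
    simp only [hΛ, γ.source, γ.target, Int.cast_neg]
    rw [hn]; ring
  rw [wind_fromPath_eq_of_lift θ γ Λ hΛc hlift (-n) hends,
    wind_fromPath_eq_of_lift θ' γ Λ' hΛ' hlift' n hn, ofAdd_neg]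

/-- **Same winding homomorphism** (as homomorphisms `π₁(X, x) → ℤ`) for `θ = θ′ + [D]`.
[cite: HatcherAT2002, Thm. 1.7 (p. 29) and its proof] -/
theorem windingHom_eq_of_eq_add_coe (θ θ' : C(X, AddCircle (1 : ℝ))) {D : X → ℝ}
    (hD : Continuous D) (h : ∀ y, θ y = θ' y + ((D y : ℝ) : AddCircle (1 : ℝ))) (x : X) :
    (fundamentalGroupAddCircleEquiv one_ne_zero (θ x)).toMonoidHom.comp
        (_root_.FundamentalGroup.map θ x) =
      (fundamentalGroupAddCircleEquiv one_ne_zero (θ' x)).toMonoidHom.comp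
        (_root_.FundamentalGroup.map θ' x) := by
  ext a
  induction a using Quotient.ind with
  | _ γ => exact wind_eq_of_eq_add_coe θ θ' hD h γ

/-- **Same kernel** of the winding homomorphisms for `θ = θ′ + [D]`.
[cite: HatcherAT2002, Thm. 1.7 (p. 29) and its proof] -/
theorem ker_windingHom_eq_of_eq_add_coe (θ θ' : C(X, AddCircle (1 : ℝ))) {D : X → ℝ}
    (hD : Continuous D) (h : ∀ y, θ y = θ' y + ((D y : ℝ) : AddCircle (1 : ℝ))) (x : X) :
    ((fundamentalGroupAddCircleEquiv one_ne_zero (θ x)).toMonoidHom.comp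
        (_root_.FundamentalGroup.map θ x)).ker =
      ((fundamentalGroupAddCircleEquiv one_ne_zero (θ' x)).toMonoidHom.comp
        (_root_.FundamentalGroup.map θ' x)).ker := by
  rw [windingHom_eq_of_eq_add_coe θ θ' hD h x]

/-- **Same kernel** of the winding homomorphisms for `θ = -θ′ + [D]` (the values are inverse
to each other, loop by loop). [cite: HatcherAT2002, Thm. 1.7 (p. 29) and its proof] -/
theorem ker_windingHom_eq_of_eq_neg_add_coe (θ θ' : C(X, AddCircle (1 : ℝ))) {D : X → ℝ}
    (hD : Continuous D) (h : ∀ y, θ y = -θ' y + ((D y : ℝ) : AddCircle (1 : ℝ))) (x : X) :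
    ((fundamentalGroupAddCircleEquiv one_ne_zero (θ x)).toMonoidHom.comp
        (_root_.FundamentalGroup.map θ x)).ker =
      ((fundamentalGroupAddCircleEquiv one_ne_zero (θ' x)).toMonoidHom.comp
        (_root_.FundamentalGroup.map θ' x)).ker := by
  ext a
  induction a using Quotient.ind with
  | _ γ =>
    rw [MonoidHom.mem_ker, MonoidHom.mem_ker, MonoidHom.comp_apply, MonoidHom.comp_apply,
      MulEquiv.coe_toMonoidHom, MulEquiv.coe_toMonoidHom]
    change fundamentalGroupAddCircleEquiv one_ne_zero (θ x) (_root_.FundamentalGroup.map θ x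
        (_root_.FundamentalGroup.fromPath (Path.Homotopic.Quotient.mk γ))) = 1 ↔
      fundamentalGroupAddCircleEquiv one_ne_zero (θ' x) (_root_.FundamentalGroup.map θ' x
        (_root_.FundamentalGroup.fromPath (Path.Homotopic.Quotient.mk γ))) = 1
    rw [wind_eq_inv_of_eq_neg_add_coe θ θ' hD h γ, inv_eq_one]

end Perturbation

/-! ### Two collapses with the same cut-off and equally signed normal coordinates -/

section Collapse

variable {Y : Type*}

/-- `clampHalf` is odd. [folklore] -/
theorem clampHalf_neg_arg (s : ℝ) : clampHalf (-s) = -clampHalf s := by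
  rcases le_total s (-2⁻¹) with h | h
  · rw [clampHalf_of_le_neg h, clampHalf_of_le (by linarith : (2⁻¹ : ℝ) ≤ -s), neg_neg]
  rcases le_total 2⁻¹ s with h' | h'
  · rw [clampHalf_of_le h', clampHalf_of_le_neg (by linarith : -s ≤ -(2⁻¹ : ℝ))]
  · rw [clampHalf_of_abs_le (abs_le.2 ⟨by linarith, h'⟩),
      clampHalf_of_abs_le (abs_le.2 ⟨by linarith, by linarith⟩)]

/-- `clampHalf 0 = 0`. [folklore] -/
theorem clampHalf_zero : clampHalf 0 = 0 :=
  clampHalf_eq_zero_iff.2 rfl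

/-- The collapse of the opposite normal coordinate is the opposite collapse (`clampHalf` is odd
and `[-1/2] = [1/2]`). [folklore] -/
theorem circleCollapse_neg_left (K ρ : Y → ℝ) (y : Y) :
    circleCollapse (fun z => -K z) ρ y = -circleCollapse K ρ y := by
  by_cases hρ : ρ y = 0
  · rw [circleCollapse_of_rho_eq_zero hρ, circleCollapse_of_rho_eq_zero hρ, ← AddCircle.coe_neg,
      coe_neg_half_eq_coe_half]
  · rw [circleCollapse_of_rho_ne_zero hρ, circleCollapse_of_rho_ne_zero hρ, ← AddCircle.coe_neg,
      neg_div, clampHalf_neg_arg]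

/-- **The difference of two collapses with the same cut-off** is the projection of the real
function `clampHalf (K/ρ) - clampHalf (K′/ρ)` (which is `0` where `ρ = 0`, by the convention
`s / 0 = 0`). [folklore] -/
theorem circleCollapse_eq_circleCollapse_add_coe (K K' ρ : Y → ℝ) (y : Y) :
    circleCollapse K ρ y = circleCollapse K' ρ y +
      (((clampHalf (K y / ρ y) - clampHalf (K' y / ρ y) : ℝ)) : AddCircle (1 : ℝ)) := by
  by_cases hρ : ρ y = 0
  · rw [circleCollapse_of_rho_eq_zero hρ, circleCollapse_of_rho_eq_zero hρ, hρ, div_zero,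
      div_zero, clampHalf_zero, sub_self, AddCircle.coe_zero, add_zero]
  · rw [circleCollapse_of_rho_ne_zero hρ, circleCollapse_of_rho_ne_zero hρ, ← AddCircle.coe_add]
    congr 1
    ring

/-- Equally signed coordinates: the first one does not vanish off `P`. [folklore] -/
theorem ne_zero_left_of_mul_pos {K K' : Y → ℝ} {N P : Set Y}
    (hsign : ∀ y ∈ N, y ∉ P → 0 < K y * K' y) : ∀ y ∈ N, y ∉ P → K y ≠ 0 :=
  fun y hy hyP h => by have := hsign y hy hyP; rw [h, zero_mul] at this; exact lt_irrefl _ this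

/-- Equally signed coordinates: the second one does not vanish off `P`. [folklore] -/
theorem ne_zero_right_of_mul_pos {K K' : Y → ℝ} {N P : Set Y}
    (hsign : ∀ y ∈ N, y ∉ P → 0 < K y * K' y) : ∀ y ∈ N, y ∉ P → K' y ≠ 0 :=
  fun y hy hyP h => by have := hsign y hy hyP; rw [h, mul_zero] at this; exact lt_irrefl _ this

/-- Oppositely signed coordinates: the first one does not vanish off `P`. [folklore] -/
theorem ne_zero_left_of_mul_neg {K K' : Y → ℝ} {N P : Set Y}
    (hsign : ∀ y ∈ N, y ∉ P → K y * K' y < 0) : ∀ y ∈ N, y ∉ P → K y ≠ 0 :=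
  fun y hy hyP h => by have := hsign y hy hyP; rw [h, zero_mul] at this; exact lt_irrefl _ this

/-- Oppositely signed coordinates: the second one does not vanish off `P`. [folklore] -/
theorem ne_zero_right_of_mul_neg {K K' : Y → ℝ} {N P : Set Y}
    (hsign : ∀ y ∈ N, y ∉ P → K y * K' y < 0) : ∀ y ∈ N, y ∉ P → K' y ≠ 0 :=
  fun y hy hyP h => by have := hsign y hy hyP; rw [h, mul_zero] at this; exact lt_irrefl _ this

/-- Two saturated clamps of equally signed arguments agree. [folklore] -/
theorem clampHalf_eq_clampHalf_of_le_abs_of_mul_pos {a b : ℝ} (ha : 2⁻¹ ≤ |a|) (hb : 2⁻¹ ≤ |b|)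
    (hab : 0 < a * b) : clampHalf a = clampHalf b := by
  rcases lt_or_gt_of_ne (show a ≠ 0 from fun h => by rw [h, zero_mul] at hab; exact lt_irrefl _ hab)
    with hneg | hpos
  · have hbneg : b < 0 := by
      by_contra hle; push Not at hle; nlinarith
    rw [abs_of_neg hneg] at ha
    rw [abs_of_neg hbneg] at hb
    rw [clampHalf_of_le_neg (by linarith), clampHalf_of_le_neg (by linarith)]
  · have hbpos : 0 < b := by
      by_contra hle; push Not at hle; nlinarith
    rw [abs_of_pos hpos] at ha
    rw [abs_of_pos hbpos] at hb
    rw [clampHalf_of_le ha, clampHalf_of_le hb]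

variable [TopologicalSpace Y]

/-- **Continuity of the difference.**  Let `N` be open, `K`, `K′` continuous on `N` and of the
same strict sign off `P` on `N` (`0 < K · K′`), `ρ` continuous with `tsupport ρ ⊆ N` and `ρ ≠ 0`
on `P`.  Then `D = clampHalf (K/ρ) - clampHalf (K′/ρ)` is continuous on all of `Y`: on
`{ρ ≠ 0} ⊆ N` it is a continuous formula; at a point of `tsupport ρ` with `ρ = 0` (a point of
`N ∖ P`) both clamps saturate nearby at the common value `sign K / 2 = sign K′ / 2`, so `D = 0`
near it; off `tsupport ρ` it is `0` near the point. [folklore] -/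
theorem continuous_collapseDiff {K K' ρ : Y → ℝ} {N P : Set Y} (hN : IsOpen N)
    (hK : ContinuousOn K N) (hK' : ContinuousOn K' N)
    (hsign : ∀ y ∈ N, y ∉ P → 0 < K y * K' y) (hρ : Continuous ρ)
    (hsupp : tsupport ρ ⊆ N) (hρP : ∀ y ∈ P, ρ y ≠ 0) :
    Continuous (fun y => clampHalf (K y / ρ y) - clampHalf (K' y / ρ y)) := by
  set D : Y → ℝ := fun y => clampHalf (K y / ρ y) - clampHalf (K' y / ρ y) with hD
  have hWN : {y | ρ y ≠ 0} ⊆ N := fun y hy => hsupp (subset_tsupport ρ hy)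
  have hWo : IsOpen {y | ρ y ≠ 0} := isOpen_ne_fun hρ continuous_const
  have hD0 : ∀ y, ρ y = 0 → D y = 0 := fun y hy => by
    simp only [hD, hy, div_zero, sub_self]
  -- on `{ρ ≠ 0}` the difference is a continuous formula
  have hformula : ContinuousOn D {y | ρ y ≠ 0} :=
    (continuous_clampHalf.comp_continuousOn
      ((hK.mono hWN).div hρ.continuousOn fun y hy => hy)).sub
    (continuous_clampHalf.comp_continuousOn
      ((hK'.mono hWN).div hρ.continuousOn fun y hy => hy))
  rw [continuous_iff_continuousAt]
  intro y₀
  by_cases h0 : ρ y₀ ≠ 0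
  · exact hformula.continuousAt (hWo.mem_nhds h0)
  push Not at h0
  -- in the remaining cases `D = 0` near `y₀`
  suffices hev : ∀ᶠ y in 𝓝 y₀, D y = 0 by
    have heq : (fun _ : Y => (0 : ℝ)) =ᶠ[𝓝 y₀] D := hev.mono fun y hy => hy.symm
    exact continuousAt_const.congr heq
  by_cases hts : y₀ ∈ tsupport ρ
  · -- `y₀ ∈ N ∖ P`: both clamps saturate at the same value nearby
    have hyN : y₀ ∈ N := hsupp hts
    have hyP : y₀ ∉ P := fun h => hρP y₀ h h0
    have hKK : 0 < K y₀ * K' y₀ := hsign y₀ hyN hyP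
    have hK0 : K y₀ ≠ 0 := ne_zero_left_of_mul_pos hsign y₀ hyN hyP
    have hK0' : K' y₀ ≠ 0 := ne_zero_right_of_mul_pos hsign y₀ hyN hyP
    set κ : ℝ := min |K y₀| |K' y₀| / 2 with hκ
    have hκK : κ < |K y₀| := by
      have h1 : min |K y₀| |K' y₀| ≤ |K y₀| := min_le_left _ _
      have h2 : 0 < |K y₀| := abs_pos.2 hK0
      rw [hκ]; linarith
    have hκK' : κ < |K' y₀| := by
      have h1 : min |K y₀| |K' y₀| ≤ |K' y₀| := min_le_right _ _
      have h2 : 0 < |K' y₀| := abs_pos.2 hK0'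
      rw [hκ]; linarith
    have hκpos : 0 < κ := by
      have := lt_min (abs_pos.2 hK0) (abs_pos.2 hK0')
      rw [hκ]; linarith
    -- the neighbourhood where `|K|, |K'| > κ`, `K K' > 0` and `|ρ| < κ`
    have hU1 : N ∩ (fun y => |K y|) ⁻¹' Ioi κ ∈ 𝓝 y₀ :=
      ((continuous_abs.comp_continuousOn hK).isOpen_inter_preimage hN isOpen_Ioi).mem_nhds
        ⟨hyN, hκK⟩
    have hU2 : N ∩ (fun y => |K' y|) ⁻¹' Ioi κ ∈ 𝓝 y₀ :=
      ((continuous_abs.comp_continuousOn hK').isOpen_inter_preimage hN isOpen_Ioi).mem_nhds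
        ⟨hyN, hκK'⟩
    have hU3 : N ∩ (fun y => K y * K' y) ⁻¹' Ioi 0 ∈ 𝓝 y₀ :=
      ((hK.mul hK').isOpen_inter_preimage hN isOpen_Ioi).mem_nhds ⟨hyN, hKK⟩
    have hU4 : (fun y => |ρ y|) ⁻¹' Iio κ ∈ 𝓝 y₀ := by
      refine ((continuous_abs.comp hρ).isOpen_preimage _ isOpen_Iio).mem_nhds ?_
      change |ρ y₀| < κ
      rw [h0, abs_zero]
      exact hκpos
    filter_upwards [hU1, hU2, hU3, hU4] with y hy1 hy2 hy3 hy4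
    by_cases hρy : ρ y = 0
    · exact hD0 y hρy
    have h1 : κ < |K y| := hy1.2
    have h2 : κ < |K' y| := hy2.2
    have h3 : 0 < K y * K' y := hy3.2
    have h4 : |ρ y| < κ := hy4
    have hρabs : 0 < |ρ y| := abs_pos.2 hρy
    have hqK : 2⁻¹ ≤ |K y / ρ y| := by
      rw [abs_div, le_div_iff₀ hρabs]; linarith
    have hqK' : 2⁻¹ ≤ |K' y / ρ y| := by
      rw [abs_div, le_div_iff₀ hρabs]; linarith
    have hsame : 0 < (K y / ρ y) * (K' y / ρ y) := by
      rw [div_mul_div_comm]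
      exact div_pos h3 (mul_self_pos.2 hρy)
    change clampHalf (K y / ρ y) - clampHalf (K' y / ρ y) = 0
    rw [clampHalf_eq_clampHalf_of_le_abs_of_mul_pos hqK hqK' hsame, sub_self]
  · -- off the support: `ρ = 0` nearby, so `D = 0` nearby
    have hopen : IsOpen (tsupport ρ)ᶜ := (isClosed_tsupport ρ).isOpen_compl
    filter_upwards [hopen.mem_nhds hts] with y hy
    exact hD0 y (image_eq_zero_of_notMem_tsupport hy)

/-- **Two collapses with equally signed normal coordinates have winding homomorphisms with the
same kernel.**  Under the hypotheses of `continuous_collapseDiff`, with `θ`, `θ′` the two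
collapses bundled as continuous maps (`circleCollapseMap`), `ker (wind ∘ θ⁎) = ker (wind ∘ θ′⁎)`
at every base point. [cite: HatcherAT2002, Thm. 1.7 (p. 29) and its proof] -/
theorem ker_windingHom_circleCollapse_eq {K K' ρ : Y → ℝ} {N P : Set Y} (hN : IsOpen N)
    (hK : ContinuousOn K N) (hK' : ContinuousOn K' N)
    (hsign : ∀ y ∈ N, y ∉ P → 0 < K y * K' y) (hρ : Continuous ρ)
    (hsupp : tsupport ρ ⊆ N) (hρP : ∀ y ∈ P, ρ y ≠ 0) (x : Y) :
    ((fundamentalGroupAddCircleEquiv one_ne_zero (circleCollapse K ρ x)).toMonoidHom.comp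
        (_root_.FundamentalGroup.map (circleCollapseMap hN hK (ne_zero_left_of_mul_pos hsign)
          hρ hsupp hρP) x)).ker =
      ((fundamentalGroupAddCircleEquiv one_ne_zero (circleCollapse K' ρ x)).toMonoidHom.comp
        (_root_.FundamentalGroup.map (circleCollapseMap hN hK' (ne_zero_right_of_mul_pos hsign)
          hρ hsupp hρP) x)).ker :=
  ker_windingHom_eq_of_eq_add_coe
    (circleCollapseMap hN hK (ne_zero_left_of_mul_pos hsign) hρ hsupp hρP)
    (circleCollapseMap hN hK' (ne_zero_right_of_mul_pos hsign) hρ hsupp hρP)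
    (continuous_collapseDiff hN hK hK' hsign hρ hsupp hρP)
    (fun y => by
      rw [circleCollapseMap_apply, circleCollapseMap_apply]
      exact circleCollapse_eq_circleCollapse_add_coe K K' ρ y) x

/-- **Two collapses with oppositely signed normal coordinates** (`K · K′ < 0` off `P`) also have
winding homomorphisms with the same kernel (their values are opposite, loop by loop).
[cite: HatcherAT2002, Thm. 1.7 (p. 29) and its proof] -/
theorem ker_windingHom_circleCollapse_eq_of_neg {K K' ρ : Y → ℝ} {N P : Set Y} (hN : IsOpen N)
    (hK : ContinuousOn K N) (hK' : ContinuousOn K' N)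
    (hsign : ∀ y ∈ N, y ∉ P → K y * K' y < 0) (hρ : Continuous ρ)
    (hsupp : tsupport ρ ⊆ N) (hρP : ∀ y ∈ P, ρ y ≠ 0) (x : Y) :
    ((fundamentalGroupAddCircleEquiv one_ne_zero (circleCollapse K ρ x)).toMonoidHom.comp
        (_root_.FundamentalGroup.map (circleCollapseMap hN hK (ne_zero_left_of_mul_neg hsign)
          hρ hsupp hρP) x)).ker =
      ((fundamentalGroupAddCircleEquiv one_ne_zero (circleCollapse K' ρ x)).toMonoidHom.comp
        (_root_.FundamentalGroup.map (circleCollapseMap hN hK' (ne_zero_right_of_mul_neg hsign)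
          hρ hsupp hρP) x)).ker := by
  -- compare `K` with `-K'` (same sign), then `-K'` with `K'` (a sign change)
  have hnK' : ContinuousOn (fun z => -K' z) N := hK'.neg
  have hsign' : ∀ y ∈ N, y ∉ P → 0 < K y * (fun z => -K' z) y := fun y hy hyP => by
    have := hsign y hy hyP
    simp only [mul_neg]; linarith
  have hD := continuous_collapseDiff hN hK hnK' hsign' hρ hsupp hρP
  refine ker_windingHom_eq_of_eq_neg_add_coe
    (circleCollapseMap hN hK (ne_zero_left_of_mul_neg hsign) hρ hsupp hρP)
    (circleCollapseMap hN hK' (ne_zero_right_of_mul_neg hsign) hρ hsupp hρP) hD (fun y => ?_) x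
  rw [circleCollapseMap_apply, circleCollapseMap_apply, ← circleCollapse_neg_left K' ρ y]
  exact circleCollapse_eq_circleCollapse_add_coe K (fun z => -K' z) ρ y

end Collapse

end Literature.AlgebraicTopology.FundamentalGroup

end
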